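import Summits.ResolutionOfSingularities.ResolutionOfSingularities.Theorems.FrobeniusLadderFInjectiveMacaulayficationFilteredChartClauseV
import HarnessLib

/-!
# Deformation across a principal fibre and the cone-away clause — POINTWISE forms (engine v2 «off orbits», brick (c₁))
# (crux `FInjectiveMacaulayfication` stmt-ResolutionOfSingularities-15315; RULING R15.48 (3) of res-L1-w45a-plan-1)

Support file (helper), chain w45a, seat res-L1-w45a-stub-4 g6. [OURS · L1 W4.5a; pointwise variants of
`ConeFibreClause.clause_atMaximal_of_fibreSurjection` (res-L1-w45a-stub-2), `FilteredChartClauseV.cone_away_clause_atMaximal_v` /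
`coneFibreClause_v` (res-L1-w45a-lead-1)] — NOT a statement of the manuscript; AI-written, weaker than expert review.

The relative filtered engine certifies a chart point of the weighted blow-up by DEFORMING the clause from the weighted tangent cone:
E1 at a maximal ideal `Q ∋ s` of the extended-Rees chart `T` reads the clause of the cone-away ring `F = T/(s)` at the ONE maximal
ideal `𝔪 = π(Q)`, and the cone-away clause at `𝔪` reads `hoff₀` at the ONE maximal ideal `𝔪 ∩ k[X]/(f₀)` of the cone.  The tree states
both steps with the hypothesis at EVERY maximal ideal; this file states them POINTWISE, so that an engine assuming `hoff₀` only OFF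
finitely many cone orbits can still certify every chart point not lying over those orbits:

* `clause_atMaximal_of_fibreSurjection_at` — `T` Noetherian domain of char `p`, `0 ≠ s`, `π : T ↠ F` with kernel `(s)`, `Q ∋ s`
  maximal; if `F_𝔪` satisfies the clause for the maximal `𝔪` with `𝔪.comap π = Q`, then `T_Q` is a domain satisfying the clause;
* `cone_away_clause_atMaximal_at` — the clause of `(k[X]/(g))[1/x̄_v^c]` at a maximal `𝔪` from the clause of `k[X]/(g)` at
  `𝔪 ∩ k[X]/(g)` (which misses `x̄_v`);
* `coneFibreClause_at` — the composite: clause of `T_Q` from `hoff₀` at the ONE maximal ideal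
  `P = (Q.map π) ∩ k[X]/(g)` of the cone.
Bodies = the tree's, with the single hypothesis application made pointwise.  No definitions, no named facts. [folklore]
-/

-- single-problem summit: the doubled namespace component is forced
set_option linter.dupNamespace false

noncomputable section

namespace Summit.ResolutionOfSingularities.ResolutionOfSingularities.Theorems.FInjectiveMacaulayfication.ConeFibreClauseAt

open IsLocalRing
open Summit.ResolutionOfSingularities.ResolutionOfSingularities.Theorems.FInjectiveMacaulayfication

/-- **Deformation across a principal fibre, POINTWISE.** `T` a Noetherian domain of characteristic `p`, `0 ≠ s ∈ T`, `π : T →+* F`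
surjective with kernel `(s)`, `Q ∋ s` a maximal ideal of `T`.  If `F_𝔪` satisfies the clause at the maximal ideal(s) `𝔪` of `F` with
`𝔪.comap π = Q` (there is exactly one, `Q.map π`), then `T_Q` is a domain satisfying the clause (`T_Q/(s) ≅ F_𝔪` and E1).
[cite: Fedder1983, Thm. 3.4 (1)]; folklore. -/
theorem clause_atMaximal_of_fibreSurjection_at (p : ℕ) [Fact p.Prime] (T : Type) [CommRing T] [IsDomain T] [IsNoetherianRing T]
    [CharP T p] (s : T) (hs : s ≠ 0) (F : Type) [CommRing F] (π : T →+* F) (hπ : Function.Surjective π)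
    (hker : RingHom.ker π = Ideal.span {s})
    (Q : Ideal T) [Q.IsMaximal] (hsQ : s ∈ Q)
    (hF : ∀ (𝔪 : Ideal F) [𝔪.IsMaximal], 𝔪.comap π = Q →
      ∀ d : ℕ, ringKrullDim (Localization.AtPrime 𝔪) = d → ∀ t : Fin d → Localization.AtPrime 𝔪,
        (Ideal.span (Set.range t)).radical.IsMaximal →
          RingTheory.Sequence.IsWeaklyRegular (Localization.AtPrime 𝔪) (List.ofFn t) ∧
          ∀ y : Localization.AtPrime 𝔪, (∃ e : ℕ, y ^ p ^ e ∈ Ideal.span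
            ((fun z : Localization.AtPrime 𝔪 => z ^ p ^ e) ''
              (Ideal.span (Set.range t) : Set (Localization.AtPrime 𝔪)))) → y ∈ Ideal.span (Set.range t)) :
    IsDomain (Localization.AtPrime Q) ∧
      ∀ d : ℕ, ringKrullDim (Localization.AtPrime Q) = d → ∀ t : Fin d → Localization.AtPrime Q,
        (Ideal.span (Set.range t)).radical.IsMaximal →
          RingTheory.Sequence.IsWeaklyRegular (Localization.AtPrime Q) (List.ofFn t) ∧
          ∀ y : Localization.AtPrime Q, (∃ e : ℕ, y ^ p ^ e ∈ Ideal.span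
            ((fun z : Localization.AtPrime Q => z ^ p ^ e) ''
              (Ideal.span (Set.range t) : Set (Localization.AtPrime Q)))) → y ∈ Ideal.span (Set.range t) := by
  refine OnExceptionalDeform.stub_onExceptionalDeform p T s hs Q hsQ ?_
  -- `Q' = Q/(s)`, a maximal ideal of `T/(s)` pulling back to `Q`
  have hkerle : RingHom.ker (Ideal.Quotient.mk (Ideal.span {s})) ≤ Q := by
    rw [Ideal.mk_ker]
    exact (Ideal.span_singleton_le_iff_mem _).mpr hsQ
  haveI hQ' : (Q.map (Ideal.Quotient.mk (Ideal.span {s}))).IsMaximal :=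
    Ideal.IsMaximal.map_of_surjective_of_ker_le Ideal.Quotient.mk_surjective hkerle
  have hQ'c : (Q.map (Ideal.Quotient.mk (Ideal.span {s}))).comap (Ideal.Quotient.mk (Ideal.span {s})) = Q := by
    rw [Ideal.comap_map_of_surjective _ Ideal.Quotient.mk_surjective, ← RingHom.ker_eq_comap_bot]
    exact sup_eq_left.mpr hkerle
  obtain ⟨e₁⟩ := QuotLocalizationIso.stub_quotLocalizationIso T s Q (Q.map (Ideal.Quotient.mk (Ideal.span {s}))) hQ'c
  -- `T/(s) ≅ F` (first isomorphism theorem), compatible with `π`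
  set e : (T ⧸ Ideal.span {s}) ≃+* F := (Ideal.quotEquivOfEq hker.symm).trans (RingHom.quotientKerEquivOfSurjective hπ) with he_def
  have he : ∀ x : T, e (Ideal.Quotient.mk (Ideal.span {s}) x) = π x := fun x => by
    rw [he_def, RingEquiv.trans_apply, Ideal.quotEquivOfEq_mk]
    exact RingHom.quotientKerEquivOfSurjective_apply_mk hπ x
  -- the maximal ideal `𝔪` of `F` corresponding to `Q'`; it lies over `Q` along `π`
  obtain ⟨𝔪, h𝔪⟩ : ∃ 𝔪 : Ideal F, 𝔪 = (Q.map (Ideal.Quotient.mk (Ideal.span {s}))).comap e.symm := ⟨_, rfl⟩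
  haveI : 𝔪.IsMaximal := by rw [h𝔪]; exact Ideal.comap_isMaximal_of_equiv e.symm
  have h𝔪π : 𝔪.comap π = Q := by
    ext x
    rw [Ideal.mem_comap, h𝔪, Ideal.mem_comap, ← he, RingEquiv.symm_apply_apply, ← Ideal.mem_comap, hQ'c]
  obtain ⟨e₂⟩ := BlowupFiModelOfCover.nonempty_ringEquiv_localization_of_ringEquiv e
    (Q.map (Ideal.Quotient.mk (Ideal.span {s}))) 𝔪 (fun x => by
      rw [h𝔪, Ideal.mem_comap, RingEquiv.symm_apply_apply])
  refine DegreeZeroDescent.inlineClause_of_ringEquiv p (e₁.trans e₂).symm ?_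
  exact hF 𝔪 h𝔪π

/-- **The localised cone is good at a closed point — POINTWISE.** The clause of `(k[X]/(g))[1/x̄_v^c]` at a maximal ideal `𝔪`
follows from the clause of `k[X]/(g)` at the maximal ideal `𝔪 ∩ k[X]/(g)` (which misses `x̄_v`); as
`FilteredChartClauseV.cone_away_clause_atMaximal_v` with the hypothesis at that one point. [folklore] -/
theorem cone_away_clause_atMaximal_at (p : ℕ) [Fact p.Prime] (k : Type) [Field k] [CharP k p] (n : ℕ)
    (g : MvPolynomial (Fin n) k) (v : Fin n) (c : ℕ) (hc : 0 < c)
    (𝔪 : Ideal (Localization.Away (Ideal.Quotient.mk (Ideal.span {g}) (MvPolynomial.X v) ^ c))) [𝔪.IsMaximal]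
    (hoffP : ∀ (P : Ideal (MvPolynomial (Fin n) k ⧸ Ideal.span {g})) [P.IsMaximal],
      P = 𝔪.under (MvPolynomial (Fin n) k ⧸ Ideal.span {g}) →
      Ideal.Quotient.mk (Ideal.span {g}) (MvPolynomial.X v) ∉ P →
      ∀ d : ℕ, ringKrullDim (Localization.AtPrime P) = d → ∀ t : Fin d → Localization.AtPrime P,
        (Ideal.span (Set.range t)).radical.IsMaximal →
          RingTheory.Sequence.IsWeaklyRegular (Localization.AtPrime P) (List.ofFn t) ∧
          ∀ y : Localization.AtPrime P, (∃ e : ℕ, y ^ p ^ e ∈ Ideal.span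
            ((fun z : Localization.AtPrime P => z ^ p ^ e) ''
              (Ideal.span (Set.range t) : Set (Localization.AtPrime P)))) → y ∈ Ideal.span (Set.range t)) :
    ∀ d : ℕ, ringKrullDim (Localization.AtPrime 𝔪) = d → ∀ t : Fin d → Localization.AtPrime 𝔪,
      (Ideal.span (Set.range t)).radical.IsMaximal →
        RingTheory.Sequence.IsWeaklyRegular (Localization.AtPrime 𝔪) (List.ofFn t) ∧
        ∀ y : Localization.AtPrime 𝔪, (∃ e : ℕ, y ^ p ^ e ∈ Ideal.span
          ((fun z : Localization.AtPrime 𝔪 => z ^ p ^ e) ''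
            (Ideal.span (Set.range t) : Set (Localization.AtPrime 𝔪)))) → y ∈ Ideal.span (Set.range t) := by
  haveI : IsJacobsonRing (MvPolynomial (Fin n) k ⧸ Ideal.span {g}) :=
    isJacobsonRing_of_finiteType (A := k) (B := MvPolynomial (Fin n) k ⧸ Ideal.span {g})
  have hP := (IsLocalization.isMaximal_iff_isMaximal_disjoint
    (Localization.Away (Ideal.Quotient.mk (Ideal.span {g}) (MvPolynomial.X v) ^ c))
    (Ideal.Quotient.mk (Ideal.span {g}) (MvPolynomial.X v) ^ c) 𝔪).mp inferInstance
  haveI : (𝔪.under (MvPolynomial (Fin n) k ⧸ Ideal.span {g})).IsMaximal := hP.1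
  have hv : Ideal.Quotient.mk (Ideal.span {g}) (MvPolynomial.X v) ∉ 𝔪.under (MvPolynomial (Fin n) k ⧸ Ideal.span {g}) :=
    fun h => hP.2 (Ideal.pow_mem_of_mem _ h c hc)
  have hcl := hoffP (𝔪.under (MvPolynomial (Fin n) k ⧸ Ideal.span {g})) rfl hv
  have e : Localization.AtPrime (𝔪.under (MvPolynomial (Fin n) k ⧸ Ideal.span {g})) ≃+* Localization.AtPrime 𝔪 :=
    (IsLocalization.localizationLocalizationAtPrimeIsoLocalization
      (Submonoid.powers (Ideal.Quotient.mk (Ideal.span {g}) (MvPolynomial.X v) ^ c)) 𝔪).toRingEquiv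
  refine DegreeZeroDescent.inlineClause_of_ringEquiv p
    (L := Localization.AtPrime (𝔪.under (MvPolynomial (Fin n) k ⧸ Ideal.span {g})))
    (L' := Localization.AtPrime 𝔪) e ?_
  exact hcl

/-- **H-G4a♮ POINTWISE** (`FilteredChartClauseV.coneFibreClause_v` at one point): `T` a Noetherian domain of characteristic `p`,
`0 ≠ s`, `π : T ↠ (k[X]/(g))[1/x̄_v^c]` with kernel `(s)`, `Q ∋ s` maximal in `T`; if `k[X]/(g)` satisfies the clause at the ONE maximal
ideal `P = (Q.map π) ∩ k[X]/(g)` (stated: at every maximal `P` missing `x̄_v` that is the contraction of a maximal `𝔪` of the cone-away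
ring with `𝔪.comap π = Q`), then `T_Q` is a domain satisfying the clause. [cite: Fedder1983, Thm. 3.4 (1)]; folklore. -/
theorem coneFibreClause_at (p : ℕ) [Fact p.Prime] (k : Type) [Field k] [CharP k p] (n : ℕ)
    (g : MvPolynomial (Fin n) k) (v : Fin n) (c : ℕ) (hc : 0 < c)
    (T : Type) [CommRing T] [IsDomain T] [IsNoetherianRing T] [CharP T p] (s : T) (hs : s ≠ 0)
    (π : T →+* Localization.Away (Ideal.Quotient.mk (Ideal.span {g}) (MvPolynomial.X v) ^ c))
    (hπ : Function.Surjective π) (hker : RingHom.ker π = Ideal.span {s})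
    (Q : Ideal T) [Q.IsMaximal] (hsQ : s ∈ Q)
    (hoffQ : ∀ (𝔪 : Ideal (Localization.Away (Ideal.Quotient.mk (Ideal.span {g}) (MvPolynomial.X v) ^ c))) [𝔪.IsMaximal],
      𝔪.comap π = Q →
      ∀ (P : Ideal (MvPolynomial (Fin n) k ⧸ Ideal.span {g})) [P.IsMaximal],
      P = 𝔪.under (MvPolynomial (Fin n) k ⧸ Ideal.span {g}) →
      Ideal.Quotient.mk (Ideal.span {g}) (MvPolynomial.X v) ∉ P →
      ∀ d : ℕ, ringKrullDim (Localization.AtPrime P) = d → ∀ t : Fin d → Localization.AtPrime P,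
        (Ideal.span (Set.range t)).radical.IsMaximal →
          RingTheory.Sequence.IsWeaklyRegular (Localization.AtPrime P) (List.ofFn t) ∧
          ∀ y : Localization.AtPrime P, (∃ e : ℕ, y ^ p ^ e ∈ Ideal.span
            ((fun z : Localization.AtPrime P => z ^ p ^ e) ''
              (Ideal.span (Set.range t) : Set (Localization.AtPrime P)))) → y ∈ Ideal.span (Set.range t)) :
    IsDomain (Localization.AtPrime Q) ∧
      ∀ d : ℕ, ringKrullDim (Localization.AtPrime Q) = d → ∀ t : Fin d → Localization.AtPrime Q,
        (Ideal.span (Set.range t)).radical.IsMaximal →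
          RingTheory.Sequence.IsWeaklyRegular (Localization.AtPrime Q) (List.ofFn t) ∧
          ∀ y : Localization.AtPrime Q, (∃ e : ℕ, y ^ p ^ e ∈ Ideal.span
            ((fun z : Localization.AtPrime Q => z ^ p ^ e) ''
              (Ideal.span (Set.range t) : Set (Localization.AtPrime Q)))) → y ∈ Ideal.span (Set.range t) :=
  clause_atMaximal_of_fibreSurjection_at p T s hs _ π hπ hker Q hsQ
    (fun 𝔪 _ h𝔪 => cone_away_clause_atMaximal_at p k n g v c hc 𝔪 (fun P _ hP hv => hoffQ 𝔪 h𝔪 P hP hv))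

end Summit.ResolutionOfSingularities.ResolutionOfSingularities.Theorems.FInjectiveMacaulayfication.ConeFibreClauseAt

end
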